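import Mathlib
import Summits.KontsevichZagierPeriods.Zeta5Search.DenomLaw.XFamilyFPArith
import Summits.KontsevichZagierPeriods.Zeta5Search.DenomLaw.ABFamilyFPPath
import Summits.KontsevichZagierPeriods.Zeta5Search.DenomLaw.PathAccountingShallow
import Summits.KontsevichZagierPeriods.Zeta5Search.DenomLaw.TS3RayPath
import HarnessLib

/-!
# ζ(5) search — PATH ACCOUNTING on the WHOLE first period of the X linear family `n·(3t+13; t+6,…,t)` (census X1, X2), ALL `t ≥ 9`, ALL `n`

Cell `pub-zeta5` (HONEST FRAMING: systematic search; no irrationality claim unless certified), TRACK «DENOM-LAW» D1 prover seat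
(denom-prover-d1 g16, `HOME/denom-law/prover-d1/ATTEMPT-16.md` §8).  The typed D2 node `DenomLaw.PathAccountingFirstPeriod` (Brown–Zudilin (28)+(30)
transported by `G ≅ S₇`, Casoratian form) on the X linear family `bLin (t n) (t n + n) n = n·(3t+13; t+6, …, t)` — the dual rays of the census's
X-directions (X1 = `t = 16`, X2 = `t = 13`) — for EVERY `t ≥ 9`, EVERY `n ≥ 1` and EVERY first-period prime (`2p > (t+12)n`), direction `j = 7`:
the DEEP cells `p ≤ (t+2)n` by THEOREM L5 / A⁗′ in the frame `(10, [1,−6,−6,1])` (`XFamilyFPCasLB.cas_ge_f3/f2` — the same frame as the TOP and A/B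
families); `(t+2,t+3]` and `((3t+13)/3, t+5]` by the Lemma-D bonus (`−12`); the other cells up to `(t+12)n` by THEOREM LB (`casLB = −13, −11, −11, −9,
−7, −5, −3, −1, 0`) with `C⋆ ≤ 10, 9, 8, 7, 6, 5, 4`; `p > (t+12)n` by g6's shallow kit.  §2 `pathAccounting_xf`; §3 **`pathAccountingFirstPeriod_on_xf` —
the node with `b := bLin (t n) (t n + n) n`, binders VERBATIM, every `t ≥ 9`, every `n ≥ 1`** (so on X1 and X2 for all `n`), and the (CV) corollary.
MODEL/structure-side valuation bookkeeping of the cell's own rationals; nothing about ζ(5); no γ; records in print UNMOVED.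
-/

open Finset

namespace Summit.KontsevichZagierPeriods.Zeta5Search.XFamFP

open Summit.KontsevichZagierPeriods.Zeta5Search.ClusterValuation
open Summit.KontsevichZagierPeriods.Zeta5Search.CasoratianValuation (InPolytope shift casoratian pairFloors refund)
open Summit.KontsevichZagierPeriods.Zeta5Search.WedgeDictionary (dOf)
open Summit.KontsevichZagierPeriods.Zeta5Search.ClassTypeCover
open Summit.KontsevichZagierPeriods.Zeta5Search.CellKit
open Summit.KontsevichZagierPeriods.Zeta5Search.XFam (xf_zero dOf_xf inPolytope_xf inPolytope_shift_xf)
open Summit.KontsevichZagierPeriods.Zeta5Search.DenomLaw (cStar FirstPeriod Sorted7 BlockGe)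
open Summit.KontsevichZagierPeriods.Zeta5Search.DenomLaw.FirstPeriodKit
  (cStar_le_eleven shallow_pairs pairFloors_eq_zero_of_shallow noMultipole_of_shallow cStar_le_of_shallow)
open Summit.KontsevichZagierPeriods.Zeta5Search.StairTS3 (refund_le_pathHead)
open Summit.KontsevichZagierPeriods.Zeta5Search.ABFamFP (head_le)

/-! ## §2 The assembly -/

/-- **`PathAccountingFirstPeriod`'s conclusion on the WHOLE first period of the X family**, direction `7`, all `t ≥ 9`, all `n ≥ 1`. -/
theorem pathAccounting_xf (t n p : ℕ) (ht : 9 ≤ t) (hn : 1 ≤ n) (hprime : p.Prime) (hF : t * n + 12 * n < 2 * p)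
    (hcas : casoratian (bLin (t * n) (t * n + n) n) 7 ≠ 0) :
    dOf (bLin (t * n) (t * n + n) n) / (p : ℤ) - pairFloors (bLin (t * n) (t * n + n) n) p
        - min (if 2 ≤ dOf (bLin (t * n) (t * n + n) n) / (p : ℤ) then (1 : ℤ) else 0) (5 - (cStar (bLin (t * n) (t * n + n) n) p : ℤ))
      ≤ padicValRat p (casoratian (bLin (t * n) (t * n + n) n) 7) := by
  haveI : Fact p.Prime := ⟨hprime⟩
  have htn : 9 * n ≤ t * n := Nat.mul_le_mul_right n ht
  have hp2 : p % 2 = 1 := Nat.odd_iff.1 (hprime.odd_of_ne_two (by omega))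
  have hLB := cas_ge_casLB htn hn hprime hF hcas
  have hC11 : (cStar (bLin (t * n) (t * n + n) n) p : ℤ) ≤ 11 := by exact_mod_cast cStar_le_eleven _ p
  have h3 := dOf_xf_div_le_three (t := t) (n := n) (p := p) hF
  -- p ≤ (t+3)n : 2 ≤ ⌊d/p⌋ ≤ 3
  by_cases hlow : p ≤ t * n + 3 * n
  · have h2 := dOf_xf_div_ge_two (t := t) (n := n) (p := p) (by omega) hprime.pos
    have hmin : -6 ≤ min (1 : ℤ) (5 - (cStar (bLin (t * n) (t * n + n) n) p : ℤ)) := le_min (by norm_num) (by linarith)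
    by_cases hd : p ≤ t * n + 2 * n
    · -- deep cells
      rw [N_le2 hd hF, if_pos h2]
      by_cases hf3 : 3 * p ≤ 2 * (t * n) + 18 * n
      · linarith [cas_ge_f3 htn hn hprime hF hf3 hd hcas]
      · push Not at hf3
        rw [dOf_xf_div_two hf3 (by omega)]
        linarith [cas_ge_f2 hn hprime hf3 hd hF hcas]
    · rw [N_x2 (by omega) hlow hF]
      have hK : (cStar (bLin (t * n) (t * n + n) n) p : ℤ) ≤ 10 := by exact_mod_cast cStar_xf_le_ten (t := t) (n := n) (p := p) (by omega)
      have hh := head_le (N := (20 : ℤ)) h2 h3 hK (by norm_num)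
      linarith [cas_ge_x2 htn hn hprime (by omega) hlow hF hcas]
  push Not at hlow
  -- (t+3)n < p, 2p ≤ d = (2t+18)n : ⌊d/p⌋ = 2 (3p > 3(t+3)n ≥ d needs tn ≥ 9n)
  by_cases hfd2 : 2 * p ≤ 2 * (t * n) + 18 * n
  · rw [dOf_xf_div_two (by omega) hfd2, if_pos (le_refl _)]
    by_cases hc3 : p ≤ t * n + 4 * n
    · have hK : (cStar (bLin (t * n) (t * n + n) n) p : ℤ) ≤ 9 := by exact_mod_cast cStar_xf_le_nine (t := t) (n := n) (p := p) hlow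
      have hm : -4 ≤ min (1 : ℤ) (5 - (cStar (bLin (t * n) (t * n + n) n) p : ℤ)) := le_min (by norm_num) (by linarith)
      rw [N_x3 hlow hc3 hF]; linarith [casLB_x3 (t := t) (n := n) (p := p) htn hn hlow hc3 hF hp2]
    have hK8 : (cStar (bLin (t * n) (t * n + n) n) p : ℤ) ≤ 8 := by exact_mod_cast cStar_xf_le_eight (t := t) (n := n) (p := p) (by omega)
    have hm8 : -3 ≤ min (1 : ℤ) (5 - (cStar (bLin (t * n) (t * n + n) n) p : ℤ)) := le_min (by norm_num) (by linarith)
    by_cases hc4a : 3 * p ≤ 3 * (t * n) + 13 * n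
    · rw [N_x4 (by omega) (by omega) hF]; linarith [casLB_x4a (t := t) (n := n) (p := p) htn hn (by omega) hc4a hF hp2]
    by_cases hc4b : p ≤ t * n + 5 * n
    · rw [N_x4 (by omega) hc4b hF]; linarith [cas_ge_x4b htn hn hprime (by omega) hc4b hF hcas]
    have hK7 : (cStar (bLin (t * n) (t * n + n) n) p : ℤ) ≤ 7 := by exact_mod_cast cStar_xf_le_seven (t := t) (n := n) (p := p) (by omega)
    have hm7 : -2 ≤ min (1 : ℤ) (5 - (cStar (bLin (t * n) (t * n + n) n) p : ℤ)) := le_min (by norm_num) (by linarith)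
    by_cases hc5 : p ≤ t * n + 6 * n
    · rw [N_x5 (by omega) hc5 hF]; linarith [casLB_x5 (t := t) (n := n) (p := p) htn hn (by omega) hc5 hp2]
    have hK6 : (cStar (bLin (t * n) (t * n + n) n) p : ℤ) ≤ 6 := by exact_mod_cast cStar_xf_le_six (t := t) (n := n) (p := p) (by omega)
    have hm6 : -1 ≤ min (1 : ℤ) (5 - (cStar (bLin (t * n) (t * n + n) n) p : ℤ)) := le_min (by norm_num) (by linarith)
    by_cases hc6 : p ≤ t * n + 7 * n
    · rw [N_x6 (by omega) hc6 hF]; linarith [casLB_x6 (t := t) (n := n) (p := p) htn hn (by omega) hc6 hp2]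
    have hK5 : (cStar (bLin (t * n) (t * n + n) n) p : ℤ) ≤ 5 := by exact_mod_cast cStar_xf_le_five (t := t) (n := n) (p := p) (by omega)
    have hm5 : 0 ≤ min (1 : ℤ) (5 - (cStar (bLin (t * n) (t * n + n) n) p : ℤ)) := le_min (by norm_num) (by linarith)
    by_cases hc7 : p ≤ t * n + 8 * n
    · rw [N_x7 (by omega) hc7 hF]; linarith [casLB_x7 (t := t) (n := n) (p := p) htn hn (by omega) hc7 hp2]
    have hK4 : (cStar (bLin (t * n) (t * n + n) n) p : ℤ) ≤ 4 := by exact_mod_cast cStar_xf_le_four (t := t) (n := n) (p := p) (by omega)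
    have hm4 : 1 ≤ min (1 : ℤ) (5 - (cStar (bLin (t * n) (t * n + n) n) p : ℤ)) := le_min le_rfl (by linarith)
    rw [N_x8 (by omega) (by omega) hF]; linarith [casLB_x8 (t := t) (n := n) (p := p) htn hn (by omega) (by omega) hp2]
  push Not at hfd2
  -- ⌊d/p⌋ = 1 up to (t+12)n
  by_cases h12 : p ≤ t * n + 12 * n
  · rw [dOf_xf_div_one hfd2 (by omega), if_neg (by norm_num)]
    have hK4 : (cStar (bLin (t * n) (t * n + n) n) p : ℤ) ≤ 4 := by exact_mod_cast cStar_xf_le_four (t := t) (n := n) (p := p) (by omega)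
    have hmin0 : (0 : ℤ) ≤ min (0 : ℤ) (5 - (cStar (bLin (t * n) (t * n + n) n) p : ℤ)) := le_min le_rfl (by linarith)
    by_cases h : p ≤ t * n + 10 * n
    · rw [N_x9 (by omega) h hF]; linarith [casLB_x9 (t := t) (n := n) (p := p) htn hn (by omega) h hp2]
    by_cases h' : p ≤ t * n + 11 * n
    · rw [N_x10 (by omega) h' hF]; linarith [casLB_x10 (t := t) (n := n) (p := p) htn hn (by omega) h' hp2]
    · rw [N_x11 (by omega) h12 hF]; linarith [casLB_x11 (t := t) (n := n) (p := p) htn hn (by omega) h12 hp2]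
  push Not at h12
  -- beyond (t+12)n: the shallow kit and (CV) without multipoles
  obtain ⟨hp5, hwin⟩ := window_xf htn hn hF
  have hb := inPolytope_xf t n
  have hs := sorted7_xf t n
  have h67 := not_blockGe67_xf h12
  have hcv := ClusterValuation.casoratianLaw_of_noMultipole _ hb (by norm_num) le_rfl (inPolytope_shift_xf t hn) hp5 hwin
    (noMultipole_of_shallow hb hs hp5 h67) hcas
  have hN := pairFloors_eq_zero_of_shallow hb hs h67
  have hC : (cStar (bLin (t * n) (t * n + n) n) p : ℤ) ≤ 5 := by exact_mod_cast (cStar_le_of_shallow (shallow_pairs hs h67)).2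
  have hd1 := dOf_xf_div_le_one (t := t) (n := n) (p := p) (by omega)
  have hd0 := dOf_xf_div_nonneg (t := t) (n := n) (p := p)
  rw [hN, if_neg (by omega), min_eq_left (by linarith)]
  unfold refund at hcv
  rw [hN, min_eq_right hd1] at hcv
  linarith

/-! ## §3 The node verbatim -/

/-- On the family the node's hypothesis `FirstPeriod` forces `(t+12)n < 2p` (the pair block `b₀ − b₆ − b₇ = (t+12)n` is `< 2p`). -/
theorem fp_bound_of_firstPeriod_xf {t n p : ℕ} (h : FirstPeriod (bLin (t * n) (t * n + n) n) p) : t * n + 12 * n < 2 * p := by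
  have := h.2 5 (by simp) 6 (by simp) (by norm_num)
  simp only [Nat.reduceAdd, v0, v6, v7] at this
  have h' : ((t * n + 12 * n : ℕ) : ℤ) < 2 * p := by push_cast; linarith
  exact_mod_cast h'

/-- **The node `PathAccountingFirstPeriod` restricted to the X family, EVERY `t ≥ 9`, literally** (all its binders, `b := bLin (t n) (t n + n) n`),
all `n ≥ 1` — in particular on the census directions X1 (`t = 16`) and X2 (`t = 13`) for all `n`. -/
theorem pathAccountingFirstPeriod_on_xf (t : ℕ) (ht : 9 ≤ t) (n p : ℕ) (hn : 1 ≤ n) :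
    InPolytope (bLin (t * n) (t * n + n) n) → Sorted7 (bLin (t * n) (t * n + n) n) →
    InPolytope (shift (bLin (t * n) (t * n + n) n) 7) → p.Prime → 5 ≤ p →
    (bLin (t * n) (t * n + n) n 0 + 2 : ℤ) < (p : ℤ) ^ 2 → FirstPeriod (bLin (t * n) (t * n + n) n) p →
    casoratian (bLin (t * n) (t * n + n) n) 7 ≠ 0 →
      dOf (bLin (t * n) (t * n + n) n) / (p : ℤ) - pairFloors (bLin (t * n) (t * n + n) n) p
          - min (if 2 ≤ dOf (bLin (t * n) (t * n + n) n) / (p : ℤ) then (1 : ℤ) else 0) (5 - (cStar (bLin (t * n) (t * n + n) n) p : ℤ))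
        ≤ padicValRat p (casoratian (bLin (t * n) (t * n + n) n) 7) :=
  fun _ _ _ hprime _ _ hfp hcas => pathAccounting_xf t n p ht hn hprime (fp_bound_of_firstPeriod_xf hfp) hcas

/-- **(CV) on the whole first-period X family, direction 7, all `t ≥ 9`, all `n`** (the (CV) value never exceeds the PATH value). -/
theorem xfRayCV_firstPeriod (t n p : ℕ) (ht : 9 ≤ t) (hn : 1 ≤ n) (hprime : p.Prime) (hF : t * n + 12 * n < 2 * p)
    (hcas : casoratian (bLin (t * n) (t * n + n) n) 7 ≠ 0) :
    refund (bLin (t * n) (t * n + n) n) p - pairFloors (bLin (t * n) (t * n + n) n) p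
      ≤ padicValRat p (casoratian (bLin (t * n) (t * n + n) n) 7) := by
  linarith [refund_le_pathHead (bLin (t * n) (t * n + n) n) p (5 - (cStar (bLin (t * n) (t * n + n) n) p : ℤ)),
    pathAccounting_xf t n p ht hn hprime hF hcas]

end Summit.KontsevichZagierPeriods.Zeta5Search.XFamFP
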